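import Summits.QuantumFields.BalabanUV.T4Continuum.Spine.NE7.QLaCriticality

/-!
# Spine/NE7/QLaConeLocality — (W-loc) at `U = 1` in the kernel: the loop variable of an `n`-fold averaged configuration depends on
# the configuration only inside a CONE of bonds below the walk (iterated `Setup.Averaging.local_dep`), so NODE S's defect bound
# charges only the part of a large-field support that meets the cone

Cell `pub-balaban-gaps` (YM blitz Y1, track G2, seat `ne7`, generation 10); text of record
`run/shared/lean/pub/pub-balaban-gaps/ne/NE7.md` (v10: §4undecies (vi)(ε), census R67).  40th `Spine/NE7/` file; 0 `def`, 0 sorry.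

WHY.  Reading (0.2)–(0.3) of [Balaban1989LargeFieldI] p. 176 as printed («Z is decomposed into disjoint subregions Z′, Z″ … Z′ is a
union of remaining components, i.e. components for which the corresponding expressions require a renormalization»): the quotient of
ONE term and step integrates over ALL its renormalised components `Z′` at once.  NODE S's defect bound `loopDefect_le_of_support`
(file 5) is stated with the GLOBAL total variation `tv(1, V)` of the supported configuration, so applied to a configuration supported
on all of `Z′` it charges components far from the loop — which cannot affect `W(avgⁿ V)` at all: the printed averaging has finite
range, typed as `Setup.Averaging.local_dep` («`avg U c` depends on `U` only on the bonds whose block is `c.src` or `c.tgt`»).  This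
file iterates that locality WITHOUT introducing a cone object (0 def): a CONE is any family of bond sets `D i ⊆ bonds of level k+i`,
`i ≤ n`, closed downwards under one-step dependence (`ConeClosed`: every bond feeding a bond of `D (i+1)` lies in `D i` — a
hypothesis the consumer discharges for his favourite neighbourhoods); then two configurations that agree on `D 0` have `n`-fold
averages that agree on `D n` (`iterFrom_congr_of_cone`), hence equal holonomies and loop variables along any walk whose bonds lie in
`D n` (`holAt_iterFrom_congr_of_cone`, `loopAt_iterFrom_congr_of_cone`), and NODE S's defect bound in CONE FORM
(`loopDefect_le_of_cone_support`): for `V ∈ dom k` whose truncation to the cone (`V` on `D 0`, `1` off it) stays in `dom k`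
(automatic for the sup-ball domains of files 20∕29∕33 — hypothesis `htrunc`), `1 − W(avgⁿ V)(walk) ≤ Cd·(|w|·|Λ ∩ D 0|·Dm)²·(θ²)ⁿ`:
only the support INSIDE the cone is charged.  How many renormalised components a GOOD history may carry inside the cone per scale is
route 1's near-support multiplicity (W-mult-F) ∕ the hybrid's `Bad` booking (rows NE7b∕NE7c), not NE7-own.

HONEST FRAMING.  Finite induction over the tree's `Setup.Averaging.local_dep`; every declaration is [folklore]; no object of Bałaban's is
constructed; the cone family is the consumer's.  NE7 NOT proved; spine 0∕9; one fixed finite T⁴ — NOT ℝ⁴, NOT infinite volume, NOT a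
mass gap, NOT Clay.  No classification word moves (R10).
-/

noncomputable section

open Finset
open scoped BigOperators

namespace Summit.QuantumFields.BalabanUV.T4Continuum.Spine.NE7

open Literature.MathematicalPhysics.QuantumFieldTheory.Balaban1983to89
open Literature.MathematicalPhysics.QuantumFieldTheory.Balaban1983to89.T4Continuum
open Literature.MathematicalPhysics.QuantumFieldTheory.Balaban1983to89.T4AvgSensitivity
open Literature.MathematicalPhysics.QuantumFieldTheory.Balaban1983to89.T4AvgDerivBound

variable {P : Params} {G : Type*} [GaugeGroup G]

/-! ## §1 Iterated locality: agreement on the base of a cone propagates to its top -/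

section Cone

/-- **ITERATED LOCALITY** (induction on `Setup.Averaging.local_dep`).  Let `D i` (`i ≤ n`) be bond sets of levels `k + i` such that
every level-`(k+i)` bond `b` whose block is an endpoint of a bond `c ∈ D (i+1)` lies in `D i` (downward closure under one-step
dependence).  If `V = V′` on `D 0`, then `avgⁱ V = avgⁱ V′` on `D i` for every `i ≤ n` with `k + i ≤ m + K`. [folklore] -/
theorem iterFrom_congr_of_cone (av : ∀ j, Averaging P j G) (k : ℕ) (D : (i : ℕ) → Set (PBond P (k + i)))
    (hclosed : ∀ i, ∀ c ∈ D (i + 1), ∀ b : PBond P (k + i),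
      (blockOf b.src = c.src ∨ blockOf b.src = c.tgt) → b ∈ D i)
    {V V' : GaugeField P k G} (h0 : ∀ b ∈ D 0, V b = V' b) :
    ∀ i : ℕ, k + i ≤ P.m + P.K → ∀ c ∈ D i, iterFrom av k i V c = iterFrom av k i V' c
  | 0, _ => fun c hc => h0 c hc
  | i + 1, hi => fun c hc => by
    rw [iterFrom_succ, iterFrom_succ]
    exact (av (k + i)).local_dep (by omega) _ _ c fun b hb =>
      iterFrom_congr_of_cone av k D hclosed h0 i (by omega) b (hclosed i c hc b hb)

/-- Hence the parallel transports along a list of steps whose bonds lie in the top of the cone agree. [folklore] -/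
theorem holAt_iterFrom_congr_of_cone (av : ∀ j, Averaging P j G) (k : ℕ) (D : (i : ℕ) → Set (PBond P (k + i)))
    (hclosed : ∀ i, ∀ c ∈ D (i + 1), ∀ b : PBond P (k + i),
      (blockOf b.src = c.src ∨ blockOf b.src = c.tgt) → b ∈ D i)
    {V V' : GaugeField P k G} (h0 : ∀ b ∈ D 0, V b = V' b) {n : ℕ} (hn : k + n ≤ P.m + P.K)
    (γ : List (LStep P (k + n))) (hγ : ∀ s ∈ γ, s.bond ∈ D n) :
    holAt (iterFrom av k n V) γ = holAt (iterFrom av k n V') γ := by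
  unfold holAt
  congr 1
  refine List.map_congr_left fun s hs => ?_
  rw [iterFrom_congr_of_cone av k D hclosed h0 n hn s.bond (hγ s hs)]

/-- … and the loop variables agree. [folklore] -/
theorem loopAt_iterFrom_congr_of_cone (av : ∀ j, Averaging P j G) (k : ℕ) (D : (i : ℕ) → Set (PBond P (k + i)))
    (hclosed : ∀ i, ∀ c ∈ D (i + 1), ∀ b : PBond P (k + i),
      (blockOf b.src = c.src ∨ blockOf b.src = c.tgt) → b ∈ D i)
    {V V' : GaugeField P k G} (h0 : ∀ b ∈ D 0, V b = V' b) {n : ℕ} (hn : k + n ≤ P.m + P.K)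
    (γ : List (LStep P (k + n))) (hγ : ∀ s ∈ γ, s.bond ∈ D n) :
    loopAt (iterFrom av k n V) γ = loopAt (iterFrom av k n V') γ := by
  rw [loopAt, loopAt, holAt_iterFrom_congr_of_cone av k D hclosed h0 hn γ hγ]

end Cone

/-! ## §2 NODE S's defect bound in cone form: only the support inside the cone is charged -/

section Defect

open Classical in
/-- **THE DEFECT BOUND IN CONE FORM.**  Under `LoopDefectBound av dom Cd θ` (file 5; PROVED for the printed averagings on the files'
domains), a cone `D` below a closed walk `(x, w)` at level `k + n` (the walk's bonds in `D n`), a configuration `V ∈ dom k` trivial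
off a finite bond set `Λ` with one-bond deviations `≤ Dm` on `Λ`, and the TRUNCATION hypothesis `htrunc` (the configuration equal to
`V` on the finite set `Λ ∩ D 0` and trivial elsewhere lies in `dom k` — automatic for sup-ball domains): `1 − W(avgⁿ V)(walk x w) ≤
Cd·(|w|·|Λ ∩ D 0|·Dm)²·(θ²)ⁿ` — the support OUTSIDE the cone is not charged. [folklore] -/
theorem loopDefect_le_of_cone_support {av : ∀ j, Averaging P j G} {dom : ∀ j, Set (GaugeField P j G)} {Cd θ : ℝ}
    (h : LoopDefectBound av dom Cd θ) (hCd : 0 ≤ Cd) (hθ : 0 ≤ θ) {k n : ℕ} (hn : k + n ≤ P.m + P.K)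
    (D : (i : ℕ) → Set (PBond P (k + i)))
    (hclosed : ∀ i, ∀ c ∈ D (i + 1), ∀ b : PBond P (k + i),
      (blockOf b.src = c.src ∨ blockOf b.src = c.tgt) → b ∈ D i)
    (x : Site P (k + n)) (w : List (Letter P.d)) (hw : walkEnd x w = x) (hwalk : ∀ s ∈ walk x w, s.bond ∈ D n)
    (V : GaugeField P k G) (h1 : (1 : GaugeField P k G) ∈ dom k) (Λ ΛD : Finset (PBond P k))
    (hΛD : ∀ b, b ∈ ΛD ↔ b ∈ Λ ∧ b ∈ D 0) (hoff : ∀ b, b ∉ Λ → V b = 1) {Dm : ℝ} (hD : ∀ b ∈ Λ, dist1 (V b) ≤ Dm)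
    (htrunc : (fun b => if b ∈ ΛD then V b else 1) ∈ dom k) :
    1 - loopAt (iterFrom av k n V) (walk x w) ≤ Cd * ((w.length : ℝ) * ΛD.card * Dm) ^ 2 * (θ ^ 2) ^ n := by
  set V' : GaugeField P k G := fun b => if b ∈ ΛD then V b else 1 with hV'
  -- `V` and its truncation agree on the base of the cone
  have h0 : ∀ b ∈ D 0, V b = V' b := by
    intro b hb
    simp only [hV']
    by_cases hbΛ : b ∈ Λ
    · rw [if_pos ((hΛD b).mpr ⟨hbΛ, hb⟩)]
    · rw [hoff b hbΛ]
      split_ifs <;> rfl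
  rw [loopAt_iterFrom_congr_of_cone av k D hclosed h0 hn (walk x w) hwalk]
  -- the truncation is supported on `ΛD` with the same one-bond deviations
  have hoff' : ∀ b, b ∉ ΛD → V' b = 1 := fun b hb => by simp only [hV', if_neg hb]
  have hD' : ∀ b ∈ ΛD, dist1 (V' b) ≤ Dm := fun b hb => by
    simp only [hV', if_pos hb]
    exact hD b ((hΛD b).mp hb).1
  exact loopDefect_le_of_support h hCd hθ hn x w hw V' htrunc h1 ΛD hoff' hD'

end Defect

end Summit.QuantumFields.BalabanUV.T4Continuum.Spine.NE7

end
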